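/-
Copyright (c) 2026. All rights reserved.
Released under Apache 2.0 license as described in the file LICENSE.
Authors: abc-iut cell, wave-4 seat abc-iut-w4-d085 ([SemiAnbd] Thm 5.4 (ii) as a reduction to (i)).
-/
import Literature.AnabelianGeometry.SemiGraphs.ArithMaximalCompact
import HarnessLib

/-!
# [SemiAnbd] Theorem 5.4 (ii): arithmetically maximal compact subgroups — reduction to (i)

Mochizuki, *Semi-graphs of anabelioids*, Publ. RIMS **42** (2006), §5, Theorem 5.4 p. 66 of the
author's manuscript [cite: MochizukiSemiAnbd2006, Thm 5.4 (ii), p. 66]: "(ii) The arithmetically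
maximal compact subgroups of `π₁^temp(𝔊)` are precisely the verticial subgroups. The arithmetically
ample intersections of two distinct arithmetically maximal compact subgroups of `π₁^temp(𝔊)` are
precisely the edge-like subgroups", typed by abc-iut-L3-t3 as the predicate
`ArithMaximalCompactStatementII D aug` on the data of p. 65 (`ArithMaximalCompact.lean`), next to
(i) `ArithMaximalCompactStatementI D aug` and Remark 5.3.1 `VerticialEdgeLikeCompactAmpleStatement D aug`.
Printed proof (p. 66): "The proof is entirely parallel to the proofs of Theorem 3.7, Corollary 3.9".

PROOF-ONLY companion (no definition, no new `Prop`), the arithmetic analogue of the tree's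
`TemperedMaximalCompact.lean` (Thm 3.7 (iv) from (ii), (iii)): it proves in the kernel that (ii) is a
FORMAL consequence of (i), of the first sentence of Remark 5.3.1, and of two structural inputs on the
verticial / edge-like subgroups which the text takes from the parallel with §3 — stated here as
INLINE hypotheses of the theorems (never as named facts):

* `hVE` "no verticial subgroup is edge-like" (the arithmetic analogue of Thm 3.7 (ii)/(iii): a
  verticial subgroup is not contained in an edge-like one), from which, with (i), nested verticial
  subgroups are equal (`eq_of_isVerticial_le`);
* `hEV` "every edge-like subgroup is the intersection of two distinct verticial subgroups" (the
  arithmetic analogue of `EdgeLikeIsInfVerticial`, p. 41: `Π_b = Π_{v} ∩ Π_{v'}` for the two — distinct,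
  the graph being untangled — end-vertices of the edge).

Main results: `isVerticial_of_isArithMaximalCompact` ((i) + Rmk 5.3.1 ⇒ "arithmetically maximal
compact ⇒ verticial"), `isArithMaximalCompact_of_isVerticial`, `isEdgeLike_of_isArithAmple_inf`
(the forward half of the second sentence, over a Hausdorff group), the assembly
`arithMaximalCompactStatementII_of`, and — for Thm 5.4 (iii) — `isArithQuasiGeometric_of_statementII`
(p. 66 "entirely parallel to … Corollary 3.9": substituting the equivalences of (ii) into the definition
of "arithmetically quasi-geometric", the arithmetic analogue of `InducedIsQuasiGeometric_of`) (with the private helper `isCompact_inf_of_isCompact`: in a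
Hausdorff group the intersection of two compact subgroups is compact). Pure group theory over Mathlib; nothing here asserts a
hypothesis of Theorem 5.4 for any data, and nothing bears on [IUTchIII] Cor. 3.12.
-/

namespace Literature.AnabelianGeometry.SemiGraphs

universe u u' w w'

variable {Gtp : Type u} [Group Gtp] [TopologicalSpace Gtp]
variable {PA : Type u'} [Group PA] [TopologicalSpace PA]
variable {V : Type w} {B : Type w'}
variable {D : DecompositionData Gtp V B} {aug : Gtp →* PA}

/-! ### Bookkeeping: arithmetic ampleness is upward closed -/

omit [TopologicalSpace Gtp] in
/-- A closed subgroup containing an arithmetically ample subgroup is arithmetically ample: its image in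
`Π_A` contains an open subgroup, hence is open (Def 5.3 (i) "surjects onto an open subgroup of `Π_A`").
[cite: MochizukiSemiAnbd2006, Def 5.3 (i), p. 65] -/
theorem IsArithAmple.mono [ContinuousMul PA] {K K' : Subgroup Gtp} (hK : IsArithAmple aug K)
    (hle : K ≤ K') : IsArithAmple aug K' :=
  Subgroup.isOpen_mono (Subgroup.map_mono hle) hK

/-! ### Arithmetically maximal compact ⇒ verticial (from (i) and Remark 5.3.1) -/

/-- **Thm 5.4 (ii), first sentence, direction ⇒** from (i) and the first sentence of Rmk 5.3.1: an
arithmetically maximal compact subgroup `K` lies in some verticial `W` by (i); `W` is compact and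
arithmetically ample by Rmk 5.3.1, so `K = W` by maximality.
[cite: MochizukiSemiAnbd2006, Thm 5.4 (ii), p. 66] -/
theorem isVerticial_of_isArithMaximalCompact (hI : ArithMaximalCompactStatementI D aug)
    (hR : VerticialEdgeLikeCompactAmpleStatement D aug) {K : Subgroup Gtp}
    (hK : IsArithMaximalCompact aug K) : IsVerticial D K := by
  obtain ⟨⟨W, hW, hKW⟩, -⟩ := hI K hK.1 hK.2.1
  obtain ⟨hWc, hWa⟩ := hR W (Or.inl hW)
  rw [← hK.2.2 W hWc hWa hKW]
  exact hW

/-! ### Nested verticial subgroups are equal (from (i), Remark 5.3.1 and `hVE`) -/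

/-- Under (i) and Rmk 5.3.1, if no verticial subgroup is edge-like, then nested verticial subgroups
coincide: were `W < W'`, the compact arithmetically ample `W` would lie in the two distinct verticial
subgroups `W, W'`, so by (i) `W ⊓ W' = W` would be edge-like (arithmetic analogue of
`eq_of_le_of_mem_verticialSubgroups`). [cite: MochizukiSemiAnbd2006, Thm 5.4 (i), p. 66] -/
theorem eq_of_isVerticial_le (hI : ArithMaximalCompactStatementI D aug)
    (hR : VerticialEdgeLikeCompactAmpleStatement D aug)
    (hVE : ∀ K : Subgroup Gtp, IsVerticial D K → ¬ IsEdgeLike D K)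
    {W W' : Subgroup Gtp} (hW : IsVerticial D W) (hW' : IsVerticial D W') (hle : W ≤ W') :
    W = W' := by
  by_contra hne
  obtain ⟨hWc, hWa⟩ := hR W (Or.inl hW)
  obtain ⟨-, h2⟩ := hI W hWc hWa
  obtain ⟨-, hedge⟩ := h2 W W' hW hW' hne le_rfl hle
  rw [inf_eq_left.mpr hle] at hedge
  exact hVE W hW hedge

/-! ### Verticial ⇒ arithmetically maximal compact -/

/-- **Thm 5.4 (ii), first sentence, direction ⇐**: a verticial subgroup is compact and arithmetically
ample (Rmk 5.3.1) and maximal among such — any larger compact arithmetically ample `K'` lies in a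
verticial `W'` by (i), and nested verticial subgroups are equal.
[cite: MochizukiSemiAnbd2006, Thm 5.4 (ii), p. 66] -/
theorem isArithMaximalCompact_of_isVerticial (hI : ArithMaximalCompactStatementI D aug)
    (hR : VerticialEdgeLikeCompactAmpleStatement D aug)
    (hinc : ∀ W W' : Subgroup Gtp, IsVerticial D W → IsVerticial D W' → W ≤ W' → W = W')
    {K : Subgroup Gtp} (hK : IsVerticial D K) : IsArithMaximalCompact aug K := by
  obtain ⟨hKc, hKa⟩ := hR K (Or.inl hK)
  refine ⟨hKc, hKa, fun K' hK'c hK'a hKK' => ?_⟩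
  obtain ⟨⟨W', hW', hK'W'⟩, -⟩ := hI K' hK'c hK'a
  have hKW' : K = W' := hinc K W' hK hW' (hKK'.trans hK'W')
  exact le_antisymm (hKW' ▸ hK'W') hKK'

/-- **Thm 5.4 (ii), first sentence** as an `iff`, from (i), Rmk 5.3.1 and the incomparability of
verticial subgroups. [cite: MochizukiSemiAnbd2006, Thm 5.4 (ii), p. 66] -/
theorem isArithMaximalCompact_iff_isVerticial (hI : ArithMaximalCompactStatementI D aug)
    (hR : VerticialEdgeLikeCompactAmpleStatement D aug)
    (hinc : ∀ W W' : Subgroup Gtp, IsVerticial D W → IsVerticial D W' → W ≤ W' → W = W')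
    (K : Subgroup Gtp) : IsArithMaximalCompact aug K ↔ IsVerticial D K :=
  ⟨isVerticial_of_isArithMaximalCompact hI hR, isArithMaximalCompact_of_isVerticial hI hR hinc⟩

/-! ### Arithmetically ample intersections of two arithmetically maximal compact subgroups -/

/-- In a Hausdorff topological group the intersection of a compact subgroup with a compact (hence
closed) subgroup is compact (private helper). [folklore] -/
private theorem isCompact_inf_of_isCompact [T2Space Gtp] {M₁ M₂ : Subgroup Gtp}
    (h₁ : IsCompact (M₁ : Set Gtp)) (h₂ : IsCompact (M₂ : Set Gtp)) :
    IsCompact ((M₁ ⊓ M₂ : Subgroup Gtp) : Set Gtp) := by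
  rw [Subgroup.coe_inf]
  exact h₁.inter_right h₂.isClosed

/-- **Thm 5.4 (ii), second sentence, direction ⇒** (Hausdorff `π₁^temp(𝔊)`): an arithmetically ample
intersection `K = M₁ ∩ M₂` of two distinct arithmetically maximal compact subgroups is edge-like —
`M₁, M₂` are verticial (first sentence), `K` is compact and arithmetically ample, and by (i) the
intersection of two distinct verticial subgroups containing such a `K` is edge-like.
[cite: MochizukiSemiAnbd2006, Thm 5.4 (ii), p. 66] -/
theorem isEdgeLike_of_isArithAmple_inf [T2Space Gtp] (hI : ArithMaximalCompactStatementI D aug)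
    (hR : VerticialEdgeLikeCompactAmpleStatement D aug) {K M₁ M₂ : Subgroup Gtp}
    (hKa : IsArithAmple aug K) (h₁ : IsArithMaximalCompact aug M₁) (h₂ : IsArithMaximalCompact aug M₂)
    (hne : M₁ ≠ M₂) (hK : K = M₁ ⊓ M₂) : IsEdgeLike D K := by
  have hV₁ := isVerticial_of_isArithMaximalCompact hI hR h₁
  have hV₂ := isVerticial_of_isArithMaximalCompact hI hR h₂
  have hKc : IsCompact (K : Set Gtp) := hK ▸ isCompact_inf_of_isCompact h₁.1 h₂.1
  obtain ⟨-, h2⟩ := hI K hKc hKa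
  obtain ⟨-, hedge⟩ := h2 M₁ M₂ hV₁ hV₂ hne (hK ▸ inf_le_left) (hK ▸ inf_le_right)
  exact hK ▸ hedge

/-- **Thm 5.4 (ii), second sentence, direction ⇐**: if every edge-like subgroup is the intersection of
two distinct verticial subgroups (`hEV`), then an edge-like `K` is arithmetically ample (Rmk 5.3.1)
and is the intersection of two distinct arithmetically maximal compact subgroups (first sentence).
[cite: MochizukiSemiAnbd2006, Thm 5.4 (ii), p. 66] -/
theorem isArithAmple_and_exists_inf_of_isEdgeLike (hI : ArithMaximalCompactStatementI D aug)
    (hR : VerticialEdgeLikeCompactAmpleStatement D aug)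
    (hinc : ∀ W W' : Subgroup Gtp, IsVerticial D W → IsVerticial D W' → W ≤ W' → W = W')
    (hEV : ∀ K : Subgroup Gtp, IsEdgeLike D K →
      ∃ W₁ W₂ : Subgroup Gtp, IsVerticial D W₁ ∧ IsVerticial D W₂ ∧ W₁ ≠ W₂ ∧ K = W₁ ⊓ W₂)
    {K : Subgroup Gtp} (hK : IsEdgeLike D K) :
    IsArithAmple aug K ∧ ∃ M₁ M₂ : Subgroup Gtp, IsArithMaximalCompact aug M₁ ∧
      IsArithMaximalCompact aug M₂ ∧ M₁ ≠ M₂ ∧ K = M₁ ⊓ M₂ := by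
  obtain ⟨W₁, W₂, hW₁, hW₂, hne, hKW⟩ := hEV K hK
  exact ⟨(hR K (Or.inr hK)).2, W₁, W₂, isArithMaximalCompact_of_isVerticial hI hR hinc hW₁,
    isArithMaximalCompact_of_isVerticial hI hR hinc hW₂, hne, hKW⟩

/-! ### Assembly: Theorem 5.4 (ii) from (i) -/

/-- **[SemiAnbd] Theorem 5.4 (ii) as a reduction** ("entirely parallel to … Theorem 3.7", p. 66): over
a Hausdorff `π₁^temp(𝔊)`, the typed statement `ArithMaximalCompactStatementII D aug` follows from
(i) `ArithMaximalCompactStatementI D aug`, the first sentence of Remark 5.3.1, the incomparability of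
verticial subgroups (`hinc`; cf. `eq_of_isVerticial_le`) and the presentation of every edge-like
subgroup as the intersection of two distinct verticial subgroups (`hEV`).
[cite: MochizukiSemiAnbd2006, Thm 5.4 (ii), p. 66] -/
theorem arithMaximalCompactStatementII_of [T2Space Gtp] (hI : ArithMaximalCompactStatementI D aug)
    (hR : VerticialEdgeLikeCompactAmpleStatement D aug)
    (hinc : ∀ W W' : Subgroup Gtp, IsVerticial D W → IsVerticial D W' → W ≤ W' → W = W')
    (hEV : ∀ K : Subgroup Gtp, IsEdgeLike D K →
      ∃ W₁ W₂ : Subgroup Gtp, IsVerticial D W₁ ∧ IsVerticial D W₂ ∧ W₁ ≠ W₂ ∧ K = W₁ ⊓ W₂) :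
    Literature.AnabelianGeometry.SemiGraphs.ArithMaximalCompactStatementII D aug := by
  refine ⟨isArithMaximalCompact_iff_isVerticial hI hR hinc, fun K => ⟨?_, ?_⟩⟩
  · rintro ⟨hKa, M₁, M₂, h₁, h₂, hne, hK⟩
    exact isEdgeLike_of_isArithAmple_inf hI hR hKa h₁ h₂ hne hK
  · exact isArithAmple_and_exists_inf_of_isEdgeLike hI hR hinc hEV

/-- **[SemiAnbd] Theorem 5.4 (ii) as a reduction**, variant with the incomparability of verticial
subgroups DERIVED from "no verticial subgroup is edge-like" (`eq_of_isVerticial_le`).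
[cite: MochizukiSemiAnbd2006, Thm 5.4 (ii), p. 66] -/
theorem arithMaximalCompactStatementII_of' [T2Space Gtp] (hI : ArithMaximalCompactStatementI D aug)
    (hR : VerticialEdgeLikeCompactAmpleStatement D aug)
    (hVE : ∀ K : Subgroup Gtp, IsVerticial D K → ¬ IsEdgeLike D K)
    (hEV : ∀ K : Subgroup Gtp, IsEdgeLike D K →
      ∃ W₁ W₂ : Subgroup Gtp, IsVerticial D W₁ ∧ IsVerticial D W₂ ∧ W₁ ≠ W₂ ∧ K = W₁ ⊓ W₂) :
    Literature.AnabelianGeometry.SemiGraphs.ArithMaximalCompactStatementII D aug :=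
  arithMaximalCompactStatementII_of hI hR (fun _ _ hW hW' hle => eq_of_isVerticial_le hI hR hVE hW hW' hle)
    hEV

/-! ### Thm 5.4 (iii), first step: "substituting the equivalences of (ii)" (arithmetic analogue of R0) -/

section QuasiGeometric

variable {Htp : Type*} [Group Htp] [TopologicalSpace Htp]
variable {V' : Type*} {B' : Type*} {D' : DecompositionData Htp V' B'} {aug' : Htp →* PA}

/-- **Thm 5.4 (iii), the step "entirely parallel to … Corollary 3.9"** (p. 66; cf. p. 42: quasi-geometricity
"follows by 'substituting' the equivalences of Theorem 3.7, (iv), into Definition 3.8" — here the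
equivalences of Thm 5.4 (ii) into the definition of "arithmetically quasi-geometric"): if both sides
satisfy the typed Thm 5.4 (ii) and a continuous homomorphism `φ` over `Π_A` maps every verticial
subgroup onto an open subgroup of a verticial subgroup and every edge-like subgroup onto an open
subgroup of an edge-like subgroup, then `φ` is arithmetically quasi-geometric.
[cite: MochizukiSemiAnbd2006, Thm 5.4 (iii), p. 66] -/
theorem isArithQuasiGeometric_of_statementII (hG : ArithMaximalCompactStatementII D aug)
    (hH : ArithMaximalCompactStatementII D' aug') {φ : Gtp →* Htp} (hφ : Continuous φ)
    (hcomp : aug'.comp φ = aug)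
    (hV : ∀ K₁ : Subgroup Gtp, IsVerticial D K₁ →
      ∃ K₂ : Subgroup Htp, IsVerticial D' K₂ ∧ MapsOntoOpenSubgroupOf φ K₁ K₂)
    (hE : ∀ K₁ : Subgroup Gtp, IsEdgeLike D K₁ →
      ∃ K₂ : Subgroup Htp, IsEdgeLike D' K₂ ∧ MapsOntoOpenSubgroupOf φ K₁ K₂) :
    Literature.AnabelianGeometry.SemiGraphs.IsArithQuasiGeometric aug aug' φ := by
  refine ⟨hφ, hcomp, fun K₁ hK₁ => ?_, fun K₁ H₁ hK₁ hH₁ hne hKa => ?_⟩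
  · obtain ⟨K₂, hK₂, hmap⟩ := hV K₁ ((hG.1 K₁).mp hK₁)
    exact ⟨K₂, (hH.1 K₂).mpr hK₂, hmap⟩
  · have hedge : IsEdgeLike D (K₁ ⊓ H₁) := (hG.2 (K₁ ⊓ H₁)).mp ⟨hKa, K₁, H₁, hK₁, hH₁, hne, rfl⟩
    obtain ⟨K₂, hK₂, hmap⟩ := hE (K₁ ⊓ H₁) hedge
    obtain ⟨hK₂a, M₁, M₂, hM₁, hM₂, hMne, hK₂eq⟩ := (hH.2 K₂).mpr hK₂
    exact ⟨M₁, M₂, hM₁, hM₂, hMne, hK₂eq ▸ hK₂a, hK₂eq ▸ hmap⟩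

end QuasiGeometric

end Literature.AnabelianGeometry.SemiGraphs
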